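import Summits.Schanuel.Schanuel.Theorems.RootDecomp1KSectorTheorem01

/-!
# RootDecomp1KSectorTheorem — lens 1, generation 67, NODE 27 «THE SECTOR THEOREM BY ONE NEWTON STEP AT (∞,∞) — THE EDGE ENGINE» — FORK (B): the FIRST-ORDER SECTOR THEOREM at FLOOR F (`thinFibreAt_of_sectorCond : c k ≠ 0 → DomZero k c → SectorCond m₀ k c → ThinFibreAt m₀ (xPolyP k c)`, every m₀ / k / monomial support, the only escape the typed residue `Residue m₀ k c`; one PROVED Diophantine input `Ridout.padicRoth_int`; CLAIM L3031, PRICE L3032, ADDENDUM L3037, RULE K-R58, NODE L3047, VERDICT L3050) — continuation (RootDecomp1KSectorTheorem02): §4  ONE NEWTON STEP: the edge polynomial is `2`-adically small at the rescaled point — 5 declarations `far_pair` … `mem_supp`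

(lens-1 g67 NODE 27 «THE SECTOR THEOREM BY ONE NEWTON STEP AT (∞,∞) — THE EDGE ENGINE» L3047: HOME kernel K = HOME/decomp-schanuel-lens-1/g67/lean/SectorTheorem.lean sha256 bbe43d14…, 2869 l, ONE namespace `Summit.Schanuel.Schanuel.Theorems.RootDecomp1KSectorTheorem`, imports the tree port …RootDecomp1KDigitPincer03 ONLY (node 26's record port; its closure holds every cell file used); no private / instance / set_option / notation / sorry / new axiom / binder / `decide` on levels; lens farm rc 0 · 0 errors · 0 sorries · warnings dupNamespace only, `--axioms` standard on the 18 deciding declarations, Probe rc 0 (g67/out/); memo g67/NODE-g67.md; CLAIM L3031 (ASK-FIRST under K-R57 (iii)); crit g12 PRICE L3032 (fork (A) ×0-AS-RECORD as posted / fork (B) a kernel meeting FLOOR F = «FIRST-ORDER SECTOR THEOREM» = THEOREM ×1 consuming K-R57 (iii); CHECKLIST K-g67 F1–F6 + S1–S8; RULE K-R58 PRE-ANNOUNCED) and PRICE ADDENDUM L3037 ((F6′) `W4P` by tree name; the ρ3 specimen `x² + x·Y² + Y⁵ + 3` of writer NOTE 17 L3036 = the F5 exhibit); census instruments LIVENESS-v36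 (key edge) / v37 (key ls2); crit g12 VERDICT L3050 (2026-09-02T03:35Z): THEOREM ×1 GRANTED under K-R57 (iii) for FORK (B) = the FIRST-ORDER SECTOR THEOREM AT FLOOR F (F1 F2 F3 (T) F4(α) F4(β) F5 F6 F6′ R-27-i and CHECKLIST S1–S8 met on the critic's own farm runs), the single ×1 of the sector line CONSUMED (K-R58 (i): no further ×1 on this line), TALLY lens-1 ×22 + THEOREM ×24, RULE K-R58 FIXED (PRICE L3032 (i)–(v) verbatim with the ADDENDUM L3037 gloss; W-27-2 = a ×0 wish for typed stratum predicates), PORT GO → census-1 (this port; PORT IDENTITY 27 owed by the seated critic). Port by census-1 gen 25 as `RootDecomp1KSectorTheorem01–10` (files ≤ 400 lines; `--supports stmt-Schanuel-33364`, the item stays OPEN; no census credit carried; RULE K-R58 (iv): UNCONDITIONAL PART ∪= these names): 01 = K l.1–307 of the prepped source (opens §1 / §2 / §3) — 20 decls `dMax`, `box`, `supp`, …, `two_zpow_inj`; 02 = K l.308–570 of the prepped source (opens §4) — 5 decls `far_pair`, `natDegree_le_dMax`, `norm_pow_sub_one_le`, …, `mem_supp`; 03 = K l.571–896 of the prepped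 source (opens §4b / §5) — 12 decls `layered_bound`, `edge_bound_one`, `edge_bound_crude`, …, `tendsto_partialSum_two`; 04 = K l.897–1221 of the prepped source (opens §6 / §7) — 10 decls `arch_finite`, `ridout_two`, `lt_rpow_neg_of_pow_mul_pow_lt`, …, `factorial_pred_le_div`; 05 = K l.1222–1500 of the prepped source (opens §8) — 4 decls `pair_levels_finite`, `dvd_lc_pow_val`, `den_le_of_dvd`, `den_rescaled_le`; 06 = K l.1501–1822 of the prepped source (opens §9) — 13 decls `size_regime`, `c_zero_ne_zero`, `far_levels_finite`, …, `sum_range_ite_shift`; 07 = K l.1823–2080 of the prepped source (inside §9) — 14 decls `layerPoly_lin2`, `layer0_lin2`, `layer1_lin2`, …, `natDegree_scaleShift`; 08 = K l.2081–2401 of the prepped source (opens §10) — 18 decls `thinFibreAt_xLinear`, `thinFibreAt_xPolyP_one`, `edgeGood_of_gap`, …, `thinFibreAt_M_sector`; 09 = K l.2402–2627 of the prepped source (opens §11) — 17 decls `sectorCond_beta0_example`, `thinFibreAt_beta0_example`, `thinFibreAt_generic_xLinear_example`, …, `rho2_two`; 10 = K l.2628–2905 of the prepped source (opens §12) — 13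 decls `residue_rho2`, `rho3`, `rho3_zero`, …, `W4P_eq`. 39 one-line docstrings synthesised for undocumented helper declarations (statements quoted, census port convention since gen 22); everything else = K VERBATIM (statements, names, proofs, K's module docstring kept in part 01 below this provenance block).)
-/

noncomputable section

namespace Summit.Schanuel.Schanuel.Theorems.RootDecomp1KSectorTheorem

open Polynomial LiouvilleNumber
open scoped Nat
open Summit.Schanuel.Schanuel.Theorems.RootDecomp1KTwoBaseCell (psNumer partialSum_eq_psNumer_div coprime_psNumer)
open Summit.Schanuel.Schanuel.Theorems.RootDecomp1KRelLiouvilleCell (partialSum_two_strictMono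
  abs_liouvilleNumber_two_sub_partialSum)
open Summit.Schanuel.Schanuel.Theorems.RootDecomp1KDegreeLadder
open Summit.Schanuel.Schanuel.Theorems.RootDecomp1KXLinear (xLinP bev_xLinP norm_ratCast_two norm_ratCast_of_le
  norm_psNumer_sub_one)
open Summit.Schanuel.Schanuel.Theorems.RootDecomp1KDigitPincer (xc XP X6P)
open Summit.Schanuel.Schanuel.Theorems.RootDecomp1KOddEmpty (W4P w4C vG natDegree_vG)
open Summit.Schanuel.Schanuel.Theorems.RootDecomp1KHyperellipticSiegel (mQ mC mC_zero mC_one mC_two natDegree_mQ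
  coeff_mQ_five leadingCoeff_mQ)
open Summit.Schanuel.Schanuel.Theorems.RootDecomp1KXLinearII (norm_aeval_le norm_psNumer)
open Summit.Schanuel.Schanuel.Theorems.RootDecomp1KXTop
open Summit.Schanuel.Schanuel.Theorems.RootDecomp1KXAll
open Summit.Schanuel.Schanuel.Theorems.RootDecomp1KLevelFinite
open Summit.Schanuel.Schanuel.Theorems.RootDecomp1KLocalExponent
open Summit.Schanuel.Schanuel.Theorems.RootDecomp1KIntegrality

/-- **THE TIE LEMMA (slope datum, exact form).**  For `N ≥ N₁` every level point `r` of `xPolyP k c` beyond the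
`2`-adic radius `R₀` determines a HULL PAIR `j₁ < j₂` of non-zero `x`-coefficients with `deg c_{j₂} < deg c_{j₁}` and
`(deg c_{j₁} − deg c_{j₂}) · log₂‖r‖₂ = (j₂ − j₁) · N! + (v₂ lc(c_{j₁}) − v₂ lc(c_{j₂}))` — the two terms of equal
maximal norm in the level identity (ultrametric tie) — and no leading monomial weighs more than the pair. -/
theorem far_pair (k : ℕ) (c : ℕ → ℤ[X]) (hB : c k ≠ 0) :
    ∃ (R₀ : ℝ) (N₁ : ℕ), 1 ≤ R₀ ∧ ∀ N, N₁ ≤ N → ∀ r : ℚ, bev (xPolyP k c) (partialSum 2 N) r = 0 →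
      R₀ < ‖(r : PadicAlgCl 2)‖ →
      ∃ j₁ j₂, j₁ < j₂ ∧ j₂ ≤ k ∧ c j₁ ≠ 0 ∧ c j₂ ≠ 0 ∧ (c j₂).natDegree < (c j₁).natDegree ∧
        (((c j₁).natDegree - (c j₂).natDegree : ℕ) : ℤ) * (-padicValRat 2 r) =
          ((j₂ - j₁ : ℕ) : ℤ) * (N ! : ℕ) +
            ((padicValInt 2 (c j₁).leadingCoeff : ℤ) - (padicValInt 2 (c j₂).leadingCoeff : ℤ)) ∧
        ∀ j, j ≤ k → c j ≠ 0 →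
          ((c j₁).natDegree - (c j₂).natDegree) * j + (j₂ - j₁) * (c j).natDegree ≤
            ((c j₁).natDegree - (c j₂).natDegree) * j₁ + (j₂ - j₁) * (c j₁).natDegree := by
  classical
  obtain ⟨T, n, hT⟩ := roots_data_all c
  set V : ℕ := ∑ j ∈ Finset.range (k + 1), padicValInt 2 (c j).leadingCoeff with hVdef
  set D : ℕ := dMax k c with hDdef
  set R₀ : ℝ := 2 ^ V + ∑ j ∈ Finset.range (k + 1), ∑ β ∈ T j, ‖β‖ with hR₀
  have hsum_nonneg : 0 ≤ ∑ j ∈ Finset.range (k + 1), ∑ β ∈ T j, ‖β‖ :=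
    Finset.sum_nonneg fun j _ => Finset.sum_nonneg fun β _ => norm_nonneg β
  have h2V : (1 : ℝ) ≤ 2 ^ V := one_le_pow₀ (by norm_num)
  have hR₀1 : 1 ≤ R₀ := by rw [hR₀]; linarith
  have hR₀V : (2 : ℝ) ^ V ≤ R₀ := by rw [hR₀]; linarith
  have hR₀β : ∀ j ∈ Finset.range (k + 1), ∀ β ∈ T j, ‖β‖ < R₀ := by
    intro j hj β hβ
    have h1 : ‖β‖ ≤ ∑ β ∈ T j, ‖β‖ := Finset.single_le_sum (f := fun β => ‖β‖) (fun β _ => norm_nonneg β) hβ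
    have h2 : ∑ β ∈ T j, ‖β‖ ≤ ∑ j ∈ Finset.range (k + 1), ∑ β ∈ T j, ‖β‖ :=
      Finset.single_le_sum (f := fun j => ∑ β ∈ T j, ‖β‖)
        (fun j _ => Finset.sum_nonneg fun β _ => norm_nonneg β) hj
    rw [hR₀]; linarith
  have hvV : ∀ j ∈ Finset.range (k + 1), padicValInt 2 (c j).leadingCoeff ≤ V := fun j hj =>
    Finset.single_le_sum (f := fun j => padicValInt 2 (c j).leadingCoeff) (fun j _ => Nat.zero_le _) hj
  have hdD : ∀ j ∈ Finset.range (k + 1), (c j).natDegree ≤ D := fun j hj =>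
    Finset.le_sup (f := fun j => (c j).natDegree) hj
  refine ⟨R₀, max 3 ((2 * D + 2) * V + 1), hR₀1, fun N hN r hP hrR => ?_⟩
  have hN3 : 3 ≤ N := le_trans (le_max_left _ _) hN
  have hNV : (2 * D + 2) * V + 1 ≤ N ! := le_trans (le_trans (le_max_right _ _) hN) (Nat.self_le_factorial N)
  -- the point, its exponent `E = log₂ ‖r‖₂`
  have hrpos : 0 < ‖(r : PadicAlgCl 2)‖ := lt_of_lt_of_le (lt_of_lt_of_le one_pos hR₀1) hrR.le
  have hr0 : r ≠ 0 := by
    intro h; rw [h, Rat.cast_zero, norm_zero] at hrpos; exact lt_irrefl _ hrpos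
  set E : ℤ := -padicValRat 2 r with hEdef
  have hρ : ‖(r : PadicAlgCl 2)‖ = (2 : ℝ) ^ E := norm_ratCast_two hr0
  have hEV : (V : ℤ) < E := by
    have h : (2 : ℝ) ^ (V : ℤ) < (2 : ℝ) ^ E := by rw [zpow_natCast, ← hρ]; exact lt_of_le_of_lt hR₀V hrR
    exact two_zpow_lt_iff.mp h
  -- the terms of the level identity and their norms
  set u : PadicAlgCl 2 := (psNumer 2 N : PadicAlgCl 2) with hudef
  have hu1 : ‖u‖ = 1 := norm_psNumer hN3
  set t : ℕ → PadicAlgCl 2 := fun j => u ^ j * 2 ^ ((k - j) * N !) * aeval (r : PadicAlgCl 2) (c j) with htdef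
  have htsum : ∑ j ∈ Finset.range (k + 1), t j = 0 := level_identity_sum k c N r hP
  set τ : ℕ → ℤ := fun j => -(((k - j) * N ! : ℕ) : ℤ) - (padicValInt 2 (c j).leadingCoeff : ℤ) +
    ((c j).natDegree : ℤ) * E with hτdef
  have hnormt : ∀ j ∈ Finset.range (k + 1), c j ≠ 0 → ‖t j‖ = (2 : ℝ) ^ τ j := by
    intro j hj hcj
    obtain ⟨hsum, hprod⟩ := hT j hcj
    have hfar : ∀ β ∈ T j, ‖β‖ < ‖(r : PadicAlgCl 2)‖ := fun β hβ => (hR₀β j hj β hβ).trans hrR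
    have hlc : (c j).leadingCoeff ≠ 0 := leadingCoeff_ne_zero.mpr hcj
    simp only [htdef]
    rw [norm_mul, norm_mul, norm_pow, hu1, one_pow, one_mul, norm_two_pow_zpow,
      norm_aeval_far hsum hprod hfar, norm_intCast_eq_zpow hlc, hρ, ← zpow_natCast, ← zpow_mul,
      ← zpow_add₀ (by norm_num : (2 : ℝ) ≠ 0), ← zpow_add₀ (by norm_num : (2 : ℝ) ≠ 0)]
    simp only [hτdef]
    congr 1
    ring
  have ht0 : ∀ j ∈ Finset.range (k + 1), t j ≠ 0 → c j ≠ 0 := by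
    intro j _ htj hcj
    apply htj
    simp only [htdef, hcj, map_zero, mul_zero]
  -- the top term is non-zero
  have htk : t k ≠ 0 := by
    have hk : k ∈ Finset.range (k + 1) := Finset.mem_range.mpr (Nat.lt_succ_self k)
    intro h0
    have h1 := hnormt k hk hB
    rw [h0, norm_zero] at h1
    exact absurd h1 (ne_of_lt (zpow_pos (by norm_num) _))
  obtain ⟨i₁, hi₁, i₂, hi₂, hne, hti₁, heq, hmax⟩ :=
    ultrametric_tie (Finset.range (k + 1)) t htsum (Finset.mem_range.mpr (Nat.lt_succ_self k)) htk
  have hci₁ : c i₁ ≠ 0 := ht0 i₁ hi₁ hti₁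
  have hti₂ : t i₂ ≠ 0 := by
    intro h0; rw [h0, norm_zero] at heq; exact hti₁ (norm_eq_zero.mp heq)
  have hci₂ : c i₂ ≠ 0 := ht0 i₂ hi₂ hti₂
  have hτeq : τ i₁ = τ i₂ := by
    have h := heq; rw [hnormt i₁ hi₁ hci₁, hnormt i₂ hi₂ hci₂] at h; exact two_zpow_inj h
  have hτle : ∀ j ∈ Finset.range (k + 1), c j ≠ 0 → τ j ≤ τ i₁ := by
    intro j hj hcj
    have h := hmax j hj; rw [hnormt j hj hcj, hnormt i₁ hi₁ hci₁] at h; exact two_zpow_le_iff.mp h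
  -- the symmetric core: from a tie pair `(a, b)` with `deg c_b < deg c_a` to the conclusion
  have key : ∀ a b, a ∈ Finset.range (k + 1) → b ∈ Finset.range (k + 1) → a ≠ b → c a ≠ 0 → c b ≠ 0 →
      τ a = τ b → (∀ j ∈ Finset.range (k + 1), c j ≠ 0 → τ j ≤ τ a) → (c b).natDegree < (c a).natDegree →
      ∃ j₁ j₂, j₁ < j₂ ∧ j₂ ≤ k ∧ c j₁ ≠ 0 ∧ c j₂ ≠ 0 ∧ (c j₂).natDegree < (c j₁).natDegree ∧
        (((c j₁).natDegree - (c j₂).natDegree : ℕ) : ℤ) * (-padicValRat 2 r) =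
          ((j₂ - j₁ : ℕ) : ℤ) * (N ! : ℕ) +
            ((padicValInt 2 (c j₁).leadingCoeff : ℤ) - (padicValInt 2 (c j₂).leadingCoeff : ℤ)) ∧
        ∀ j, j ≤ k → c j ≠ 0 →
          ((c j₁).natDegree - (c j₂).natDegree) * j + (j₂ - j₁) * (c j).natDegree ≤
            ((c j₁).natDegree - (c j₂).natDegree) * j₁ + (j₂ - j₁) * (c j₁).natDegree := by
    intro a b ha hb hab hca hcb hτab hτmax hdab
    have hak : a ≤ k := by have := Finset.mem_range.mp ha; omega
    have hbk : b ≤ k := by have := Finset.mem_range.mp hb; omega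
    have hva : (padicValInt 2 (c a).leadingCoeff : ℤ) ≤ V := by exact_mod_cast hvV a ha
    have hvb : (padicValInt 2 (c b).leadingCoeff : ℤ) ≤ V := by exact_mod_cast hvV b hb
    have hva0 : (0 : ℤ) ≤ padicValInt 2 (c a).leadingCoeff := by positivity
    have hvb0 : (0 : ℤ) ≤ padicValInt 2 (c b).leadingCoeff := by positivity
    -- the tie equation in `ℤ`
    have heqZ : ((c a).natDegree - (c b).natDegree : ℤ) * E =
        ((b : ℤ) - a) * (N ! : ℕ) +
          ((padicValInt 2 (c a).leadingCoeff : ℤ) - (padicValInt 2 (c b).leadingCoeff : ℤ)) := by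
      have h := hτab
      simp only [hτdef] at h
      have e1 : (((k - a) * N ! : ℕ) : ℤ) = ((k : ℤ) - a) * (N ! : ℕ) := by
        rw [Nat.cast_mul, Nat.cast_sub hak]
      have e2 : (((k - b) * N ! : ℕ) : ℤ) = ((k : ℤ) - b) * (N ! : ℕ) := by
        rw [Nat.cast_mul, Nat.cast_sub hbk]
      rw [e1, e2] at h
      linear_combination h
    -- hence `b > a`
    have hNpos : (0 : ℤ) < (N ! : ℕ) := by exact_mod_cast Nat.factorial_pos N
    have hq1 : (1 : ℤ) ≤ ((c a).natDegree : ℤ) - (c b).natDegree := by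
      have : ((c b).natDegree : ℤ) < (c a).natDegree := by exact_mod_cast hdab
      omega
    have hba : a < b := by
      by_contra hle
      push Not at hle
      have hba' : (b : ℤ) ≤ a := by exact_mod_cast hle
      have hle' : (b : ℤ) - a ≤ 0 := by linarith
      have h1 : ((b : ℤ) - a) * (N ! : ℕ) ≤ 0 := mul_nonpos_of_nonpos_of_nonneg hle' hNpos.le
      have h2 : (1 : ℤ) * E ≤ (((c a).natDegree : ℤ) - (c b).natDegree) * E :=
        mul_le_mul_of_nonneg_right hq1 (by linarith)
      linarith
    refine ⟨a, b, hba, hbk, hca, hcb, hdab, ?_, ?_⟩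
    · rw [Nat.cast_sub hdab.le, Nat.cast_sub hba.le]
      exact heqZ
    · intro j hjk hcj
      have hj : j ∈ Finset.range (k + 1) := Finset.mem_range.mpr (by omega)
      have hτj := hτmax j hj hcj
      simp only [hτdef] at hτj
      have e1 : (((k - a) * N ! : ℕ) : ℤ) = ((k : ℤ) - a) * (N ! : ℕ) := by
        rw [Nat.cast_mul, Nat.cast_sub hak]
      have e3 : (((k - j) * N ! : ℕ) : ℤ) = ((k : ℤ) - j) * (N ! : ℕ) := by
        rw [Nat.cast_mul, Nat.cast_sub hjk]
      rw [e1, e3] at hτj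
      have hvj : (padicValInt 2 (c j).leadingCoeff : ℤ) ≤ V := by exact_mod_cast hvV j hj
      have hvj0 : (0 : ℤ) ≤ padicValInt 2 (c j).leadingCoeff := by positivity
      have hdj : ((c j).natDegree : ℤ) ≤ D := by exact_mod_cast hdD j hj
      have hda : ((c a).natDegree : ℤ) ≤ D := by exact_mod_cast hdD a ha
      have hNV' : ((2 * D + 2) * V + 1 : ℤ) ≤ (N ! : ℕ) := by exact_mod_cast hNV
      -- `(j − a)·N! + (d_j − d_a)·E ≤ v_j − v_a ≤ V`
      have h1 : ((j : ℤ) - a) * (N ! : ℕ) + (((c j).natDegree : ℤ) - (c a).natDegree) * E ≤ V := by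
        linarith
      -- multiply by `q = d_a − d_b ≥ 1` and substitute `q·E = s·N! + Δ`
      set q : ℤ := ((c a).natDegree : ℤ) - (c b).natDegree with hqdef
      set s : ℤ := (b : ℤ) - a with hsdef
      set Δ : ℤ := (padicValInt 2 (c a).leadingCoeff : ℤ) - (padicValInt 2 (c b).leadingCoeff : ℤ) with hΔ
      have hq0 : 0 ≤ q := by linarith
      have hdb0 : (0 : ℤ) ≤ (c b).natDegree := by positivity
      have hqD : q ≤ D := by linarith
      have hΔV : |Δ| ≤ V := by rw [abs_le]; constructor <;> linarith
      have hdjD : |((c j).natDegree : ℤ) - (c a).natDegree| ≤ D := by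
        have : (0 : ℤ) ≤ (c j).natDegree := by positivity
        have : (0 : ℤ) ≤ (c a).natDegree := by positivity
        rw [abs_le]; constructor <;> linarith
      have h2 : q * (((j : ℤ) - a) * (N ! : ℕ)) + (((c j).natDegree : ℤ) - (c a).natDegree) * (q * E) ≤ q * V := by
        have := mul_le_mul_of_nonneg_left h1 hq0
        linarith [this]
      rw [heqZ] at h2
      -- `N! · X ≤ q·V − (d_j − d_a)·Δ ≤ (q + D)·V`
      set X : ℤ := q * ((j : ℤ) - a) + s * (((c j).natDegree : ℤ) - (c a).natDegree) with hXdef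
      have h3 : (N ! : ℕ) * X ≤ q * V + |((c j).natDegree : ℤ) - (c a).natDegree| * |Δ| := by
        have hprod : -((((c j).natDegree : ℤ) - (c a).natDegree) * Δ) ≤
            |((c j).natDegree : ℤ) - (c a).natDegree| * |Δ| := by
          rw [← abs_mul]; exact neg_le_abs _
        have hexp : ((N ! : ℕ) : ℤ) * X = q * (((j : ℤ) - a) * (N ! : ℕ)) +
            (((c j).natDegree : ℤ) - (c a).natDegree) * (s * (N ! : ℕ)) := by rw [hXdef]; ring
        linarith
      have hV0 : (0 : ℤ) ≤ V := by positivity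
      have hD0 : (0 : ℤ) ≤ D := by positivity
      have h4 : |((c j).natDegree : ℤ) - (c a).natDegree| * |Δ| ≤ D * V :=
        mul_le_mul hdjD hΔV (abs_nonneg _) hD0
      have hqV : q * (V : ℤ) ≤ D * V := mul_le_mul_of_nonneg_right hqD hV0
      have hX : X ≤ 0 := by
        by_contra hX
        push Not at hX
        have hX1 : 1 ≤ X := hX
        have h5 : ((N ! : ℕ) : ℤ) ≤ (N ! : ℕ) * X := le_mul_of_one_le_right hNpos.le hX1
        linarith
      -- back to `ℕ`
      have hfinal : (((c a).natDegree - (c b).natDegree : ℕ) : ℤ) * j + ((b - a : ℕ) : ℤ) * (c j).natDegree ≤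
          (((c a).natDegree - (c b).natDegree : ℕ) : ℤ) * a + ((b - a : ℕ) : ℤ) * (c a).natDegree := by
        rw [Nat.cast_sub hdab.le, Nat.cast_sub hba.le]
        have : X = q * (j : ℤ) + s * ((c j).natDegree : ℤ) - (q * a + s * (c a).natDegree) := by
          rw [hXdef]; ring
        linarith
      exact_mod_cast hfinal
  -- the degrees of the tie pair differ; order them
  have hV_lt : (V : ℤ) < (N ! : ℕ) := by
    have h1 : V ≤ (2 * D + 2) * V := Nat.le_mul_of_pos_left V (by omega)
    have : V < N ! := by omega
    exact_mod_cast this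
  rcases lt_trichotomy (c i₂).natDegree (c i₁).natDegree with hlt | heqd | hgt
  · exact key i₁ i₂ hi₁ hi₂ hne hci₁ hci₂ hτeq hτle hlt
  · exfalso
    have hak : i₁ ≤ k := by have := Finset.mem_range.mp hi₁; omega
    have hbk : i₂ ≤ k := by have := Finset.mem_range.mp hi₂; omega
    have h := hτeq
    simp only [hτdef] at h
    have e1 : (((k - i₁) * N ! : ℕ) : ℤ) = ((k : ℤ) - i₁) * (N ! : ℕ) := by
      rw [Nat.cast_mul, Nat.cast_sub hak]
    have e2 : (((k - i₂) * N ! : ℕ) : ℤ) = ((k : ℤ) - i₂) * (N ! : ℕ) := by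
      rw [Nat.cast_mul, Nat.cast_sub hbk]
    rw [e1, e2, heqd] at h
    -- `(i₁ − i₂)·N! = v₁ − v₂`, `|v₁ − v₂| ≤ V < N!`, so `i₁ = i₂`
    have hv1 : (padicValInt 2 (c i₁).leadingCoeff : ℤ) ≤ V := by exact_mod_cast hvV i₁ hi₁
    have hv2 : (padicValInt 2 (c i₂).leadingCoeff : ℤ) ≤ V := by exact_mod_cast hvV i₂ hi₂
    have hv10 : (0 : ℤ) ≤ padicValInt 2 (c i₁).leadingCoeff := by positivity
    have hv20 : (0 : ℤ) ≤ padicValInt 2 (c i₂).leadingCoeff := by positivity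
    have hmul : ((i₁ : ℤ) - i₂) * (N ! : ℕ) =
        (padicValInt 2 (c i₁).leadingCoeff : ℤ) - padicValInt 2 (c i₂).leadingCoeff := by linear_combination h
    have hNpos : (0 : ℤ) < (N ! : ℕ) := by exact_mod_cast Nat.factorial_pos N
    rcases lt_trichotomy (i₁ : ℤ) i₂ with h12 | h12 | h12
    · have h12' : (i₁ : ℤ) - i₂ ≤ -1 := by linarith
      have : ((i₁ : ℤ) - i₂) * (N ! : ℕ) ≤ (-1) * (N ! : ℕ) := mul_le_mul_of_nonneg_right h12' hNpos.le
      linarith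
    · exact hne (by exact_mod_cast h12)
    · have h12' : (1 : ℤ) ≤ (i₁ : ℤ) - i₂ := by linarith
      have : (1 : ℤ) * (N ! : ℕ) ≤ ((i₁ : ℤ) - i₂) * (N ! : ℕ) := mul_le_mul_of_nonneg_right h12' hNpos.le
      linarith
  · have hτle' : ∀ j ∈ Finset.range (k + 1), c j ≠ 0 → τ j ≤ τ i₂ := by
      intro j hj hcj; rw [← hτeq]; exact hτle j hj hcj
    exact key i₂ i₁ hi₂ hi₁ hne.symm hci₂ hci₁ hτeq.symm hτle' hgt

/-! ## §4  ONE NEWTON STEP: the edge polynomial is `2`-adically small at the rescaled point -/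

/-- `{k : ℕ} (c : ℕ → ℤ[X]) {j : ℕ} (hj : j ≤ k) : (c j).natDegree ≤ dMax k c`. -/
theorem natDegree_le_dMax {k : ℕ} (c : ℕ → ℤ[X]) {j : ℕ} (hj : j ≤ k) : (c j).natDegree ≤ dMax k c :=
  Finset.le_sup (f := fun j => (c j).natDegree) (Finset.mem_range.mpr (Nat.lt_succ_of_le hj))

/-- `‖p_N^j − 1‖₂ ≤ ‖p_N − 1‖₂`. -/
theorem norm_pow_sub_one_le {u : PadicAlgCl 2} (hu : ‖u‖ ≤ 1) (j : ℕ) : ‖u ^ j - 1‖ ≤ ‖u - 1‖ := by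
  have h : u ^ j - 1 = (∑ i ∈ Finset.range j, u ^ i) * (u - 1) := (geom_sum_mul u j).symm
  rw [h, norm_mul]
  have h1 : ‖∑ i ∈ Finset.range j, u ^ i‖ ≤ 1 :=
    IsUltrametricDist.norm_sum_le_of_forall_le_of_nonneg zero_le_one fun i _ => by
      rw [norm_pow]; exact pow_le_one₀ (norm_nonneg _) hu
  calc ‖∑ i ∈ Finset.range j, u ^ i‖ * ‖u - 1‖ ≤ 1 * ‖u - 1‖ :=
        mul_le_mul_of_nonneg_right h1 (norm_nonneg _)
    _ = ‖u - 1‖ := one_mul _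

/-- the value of the edge polynomial as a sum over the edge. -/
theorem aeval_layerPoly (k : ℕ) (c : ℕ → ℤ[X]) (s q M g : ℕ) (z : PadicAlgCl 2) :
    aeval z (layerPoly k c s q M g) =
      ∑ p ∈ (supp k c).filter (fun p => q * p.1 + s * p.2 + g = M),
        ((c p.1).coeff p.2 : PadicAlgCl 2) * z ^ p.2 := by
  simp only [layerPoly, map_sum, map_mul, map_pow, aeval_X, eq_intCast, map_intCast]

/-- `{k : ℕ} {c : ℕ → ℤ[X]} {p : ℕ × ℕ} (hp : p ∈ supp k c) : p.1 ≤ k ∧ p.2 ≤ dMax k c ∧ (c p.1).coeff p.2 ≠ 0`. -/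
theorem mem_supp {k : ℕ} {c : ℕ → ℤ[X]} {p : ℕ × ℕ} (hp : p ∈ supp k c) :
    p.1 ≤ k ∧ p.2 ≤ dMax k c ∧ (c p.1).coeff p.2 ≠ 0 := by
  simp only [supp, box, Finset.mem_filter, Finset.mem_product, Finset.mem_range] at hp
  exact ⟨by omega, by omega, hp.2⟩

end Summit.Schanuel.Schanuel.Theorems.RootDecomp1KSectorTheorem
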